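import Summits.CriticalPhenomena.PercolationContinuityZ3.Theorems.PercNearOneGluingNoHeavyLowerTailQ7ThreeRobust
import HarnessLib

/-!
# `NoHeavyLowerTail` (stmt-CriticalPhenomena-4575) — the ROBUST SPECTATOR EXCHANGE: Kozma–Nitzan's gluing
# inequality (9) with a spectator vertex, for EVERY ranking (LEMMA T of the formal-face programme, both cases)

Support file (lemma factory `prim-lf-3` gen 13; `--supports stmt-CriticalPhenomena-4575`).  No definitions, no named
facts, no sorries.  Memo: `run/shared/lean/prim/prim-lf-3/LF3-BETA-R.md` §16–17 (regime I = A′ of the formal face of the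
`2 + (any law)` kernel needs exactly the case "the spectator is the weakest", called T(i) there; gen 11's
`UpsetExchange.spectatorExchange` is the case "an endpoint of the pair is the weakest", T(ii)).

Setting: any finite weighted graph `w`, a target `b`, a pair `A = {p, p′}` (to be glued), a spectator `j` and a further
vertex `z`; write `a_v = P(v↔b)` and

  `D := P((p↔b ∪ p′↔b), z↮b, z↮p, z↮p′, z↮j) − P(z↔b, p↮b, p′↮b, (j↔p ∪ j↔p′))`

(through the glued pair `X = [pp′]` this is the difference of the gains of `z` and of `j` when `X` and `z` are merged).
Kozma–Nitzan's (9) (arXiv:2401.12397, pp. 9–10) is the display without the spectator.  THIS FILE proves, with NO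
reliability hypothesis at all (`spectatorExchange_robust`),

  `a_p − a_z − (a_p − a_{p′})⁺ − (a_p − a_j)⁺ ≤ D`      (written with `min(·,0)`),

hence (`spectatorExchange_min`)  `min(a_p, a_{p′}, a_j) − a_z ≤ D`  for every ranking of `p, p′, j`, and in particular
the spectator-weakest case (`spectatorExchange_weakest`): if `a_j ≤ a_p` and `a_j ≤ a_{p′}` then `a_j − a_z ≤ D`.
Proof: the robust Question-7 inequality for three relays of the coupling seat (`Q7Psi.q7_three_robust`, unconditional,
CSH-free) at observer `z`, relays `{p′, j, p}`, designated relay `p`: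
`min(a_{p′} − a_p, 0) + min(a_j − a_p, 0) ≤ μ(z↔b, U) − μ(p↔b, U)`, `U = {z↔p′} ∪ {z↔j} ∪ {z↔p}`; off `U` the two
inclusions `{p↔b} ⊆ {A↔b, z ≁ b,p,p′,j}` and `{z↔b, A↮b, j↔A} ⊆ {z↔b}` finish, exactly as in gen 11's file.  The point
missed in §16d of the memo: designate the weaker PORT (not the spectator) and let the robust slack `(a_p − a_j)⁺` be paid
by the hypothesis `a_j ≤ a_p` — the "unsigned isolation term" `T_free` never has to be controlled.
-/

namespace Summit.CriticalPhenomena.PercolationContinuityZ3.Theorems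

open MeasureTheory Set Literature.Probability.LatticeModels Literature.Probability.Percolation
open scoped Classical

noncomputable section

namespace UpsetExchange

universe u

variable {V : Type u} [Fintype V]

/-- **Robust spectator exchange** (KN's (9) with a spectator, no reliability hypothesis): with `D` as in the module
docstring, `a_p − a_z + min(a_{p′} − a_p, 0) + min(a_j − a_p, 0) ≤ D`.
[cite: KozmaNitzan2024, Lemma 4 and (9) (pp. 9–10), Question 7 (p. 36)] -/
theorem spectatorExchange_robust (w : Sym2 V → unitInterval) (b z j p p' : V)
    (hzb : z ≠ b) (hpb : p ≠ b) (hp'b : p' ≠ b) (hjb : j ≠ b) (hpp' : p ≠ p') (hpj : p ≠ j) (hp'j : p' ≠ j) :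
    (prodBernoulli w).real (openConn p b) - (prodBernoulli w).real (openConn z b) +
        min ((prodBernoulli w).real (openConn p' b) - (prodBernoulli w).real (openConn p b)) 0 +
        min ((prodBernoulli w).real (openConn j b) - (prodBernoulli w).real (openConn p b)) 0 ≤
      (prodBernoulli w).real ((openConn p b ∪ openConn p' b) ∩ (openConn z b)ᶜ ∩ (openConn z p)ᶜ ∩
          (openConn z p')ᶜ ∩ (openConn z j)ᶜ) -
        (prodBernoulli w).real (openConn z b ∩ (openConn p b)ᶜ ∩ (openConn p' b)ᶜ ∩ (openConn j p ∪ openConn j p')) := by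
  set μ := prodBernoulli w with hμ
  have hmeas : ∀ X : Set (BondConfig V), MeasurableSet X := fun _ => MeasurableSet.of_discrete
  -- the observer event of `z` towards the three relays `p', j, p`
  set U : Set (BondConfig V) := openConn z p' ∪ openConn z j ∪ openConn z p with hU
  -- robust Question 7 for three relays, observer `z`, designated relay `p`
  have hq7 : min (μ.real (openConn p' b) - μ.real (openConn p b)) 0 +
      min (μ.real (openConn j b) - μ.real (openConn p b)) 0 ≤
      μ.real (openConn z b ∩ U) - μ.real (openConn p b ∩ U) :=
    Q7Psi.q7_three_robust w z b p' j p hzb hp'b hjb hpb hp'j hpp'.symm hpj.symm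
  -- split both reliabilities along `U`
  have hsp := measureReal_inter_add_sdiff (μ := μ) (s := openConn p b) (hmeas U) (measure_ne_top _ _)
  have hsz := measureReal_inter_add_sdiff (μ := μ) (s := openConn z b) (hmeas U) (measure_ne_top _ _)
  -- off `U`: `{p↔b} ⊆ {A↔b, z ≁ b,p,p',j}`
  have h1 : μ.real (openConn p b \ U) ≤
      μ.real ((openConn p b ∪ openConn p' b) ∩ (openConn z b)ᶜ ∩ (openConn z p)ᶜ ∩ (openConn z p')ᶜ ∩ (openConn z j)ᶜ) := by
    apply measureReal_mono
    · rintro ω ⟨hpbω, hUω⟩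
      simp only [hU, mem_union, not_or] at hUω
      obtain ⟨⟨hzp', hzj⟩, hzp⟩ := hUω
      refine ⟨⟨⟨⟨Or.inl hpbω, fun hzbω => hzp ?_⟩, hzp⟩, hzp'⟩, hzj⟩
      exact (hzbω : (openGraph ω).Reachable z b).trans (hpbω : (openGraph ω).Reachable p b).symm
    · exact measure_ne_top _ _
  -- off `U`: `{z↔b, A↮b, j↔A} ⊆ {z↔b} \ U`
  have h2 : μ.real (openConn z b ∩ (openConn p b)ᶜ ∩ (openConn p' b)ᶜ ∩ (openConn j p ∪ openConn j p')) ≤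
      μ.real (openConn z b \ U) := by
    apply measureReal_mono
    · rintro ω ⟨⟨⟨hzbω, hpbω⟩, hp'bω⟩, hjA⟩
      refine ⟨hzbω, ?_⟩
      simp only [hU, mem_union, not_or]
      refine ⟨⟨fun hzp' => hp'bω ?_, fun hzj => ?_⟩, fun hzp => hpbω ?_⟩
      · exact (hzp' : (openGraph ω).Reachable z p').symm.trans (hzbω : (openGraph ω).Reachable z b)
      · rcases hjA with hjp | hjp'
        · exact hpbω (((hjp : (openGraph ω).Reachable j p).symm.trans
            (hzj : (openGraph ω).Reachable z j).symm).trans (hzbω : (openGraph ω).Reachable z b))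
        · exact hp'bω (((hjp' : (openGraph ω).Reachable j p').symm.trans
            (hzj : (openGraph ω).Reachable z j).symm).trans (hzbω : (openGraph ω).Reachable z b))
      · exact (hzp : (openGraph ω).Reachable z p).symm.trans (hzbω : (openGraph ω).Reachable z b)
    · exact measure_ne_top _ _
  linarith

/-- **Spectator exchange for every ranking** (LEMMA T of the memo, cases (i) and (ii) at once): with `D` as in the module
docstring, `min(min(a_p, a_{p′}), a_j) − a_z ≤ D`.  From `spectatorExchange_robust` with the weaker port designated.
[cite: KozmaNitzan2024, Lemma 4 and (9) (pp. 9–10), Question 7 (p. 36)] -/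
theorem spectatorExchange_min (w : Sym2 V → unitInterval) (b z j p p' : V)
    (hzb : z ≠ b) (hpb : p ≠ b) (hp'b : p' ≠ b) (hjb : j ≠ b) (hpp' : p ≠ p') (hpj : p ≠ j) (hp'j : p' ≠ j) :
    min (min ((prodBernoulli w).real (openConn p b)) ((prodBernoulli w).real (openConn p' b)))
          ((prodBernoulli w).real (openConn j b)) - (prodBernoulli w).real (openConn z b) ≤
      (prodBernoulli w).real ((openConn p b ∪ openConn p' b) ∩ (openConn z b)ᶜ ∩ (openConn z p)ᶜ ∩
          (openConn z p')ᶜ ∩ (openConn z j)ᶜ) -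
        (prodBernoulli w).real (openConn z b ∩ (openConn p b)ᶜ ∩ (openConn p' b)ᶜ ∩ (openConn j p ∪ openConn j p')) := by
  set μ := prodBernoulli w with hμ
  set ap := μ.real (openConn p b) with hap
  set aq := μ.real (openConn p' b) with haq
  set aj := μ.real (openConn j b) with haj
  set az := μ.real (openConn z b) with haz
  by_cases hle : ap ≤ aq
  · -- designate `p`
    have key := spectatorExchange_robust w b z j p p' hzb hpb hp'b hjb hpp' hpj hp'j
    have m1 : min (aq - ap) 0 = 0 := min_eq_right (by linarith)
    have m0 : min ap aq = ap := min_eq_left hle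
    rw [m0]
    by_cases hj : aj ≤ ap
    · have m2 : min (aj - ap) 0 = aj - ap := min_eq_left (by linarith)
      have m3 : min ap aj = aj := min_eq_right hj
      rw [m3]
      rw [← hap, ← haq, ← haj, ← haz, m1, m2] at key
      linarith
    · have m2 : min (aj - ap) 0 = 0 := min_eq_right (by linarith)
      have m3 : min ap aj = ap := min_eq_left (by linarith)
      rw [m3]
      rw [← hap, ← haq, ← haj, ← haz, m1, m2] at key
      linarith
  · -- designate `p'`: the same inequality with the roles of `p` and `p'` exchanged
    have key := spectatorExchange_robust w b z j p' p hzb hp'b hpb hjb (Ne.symm hpp') hp'j hpj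
    have hE1 : ((openConn p' b ∪ openConn p b) ∩ (openConn z b)ᶜ ∩ (openConn z p')ᶜ ∩ (openConn z p)ᶜ ∩
        (openConn z j)ᶜ : Set (BondConfig V)) =
        (openConn p b ∪ openConn p' b) ∩ (openConn z b)ᶜ ∩ (openConn z p)ᶜ ∩ (openConn z p')ᶜ ∩ (openConn z j)ᶜ := by
      ext ω
      simp only [mem_inter_iff, mem_union, mem_compl_iff]
      tauto
    have hE2 : (openConn z b ∩ (openConn p' b)ᶜ ∩ (openConn p b)ᶜ ∩ (openConn j p' ∪ openConn j p) :
        Set (BondConfig V)) =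
        openConn z b ∩ (openConn p b)ᶜ ∩ (openConn p' b)ᶜ ∩ (openConn j p ∪ openConn j p') := by
      ext ω
      simp only [mem_inter_iff, mem_union, mem_compl_iff]
      tauto
    rw [hE1, hE2] at key
    have hle' : aq ≤ ap := le_of_lt (lt_of_not_ge hle)
    have m1 : min (ap - aq) 0 = 0 := min_eq_right (by linarith)
    have m0 : min ap aq = aq := min_eq_right hle'
    rw [m0]
    by_cases hj : aj ≤ aq
    · have m2 : min (aj - aq) 0 = aj - aq := min_eq_left (by linarith)
      have m3 : min aq aj = aj := min_eq_right hj
      rw [m3]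
      rw [← hap, ← haq, ← haj, ← haz, m1, m2] at key
      linarith
    · have m2 : min (aj - aq) 0 = 0 := min_eq_right (by linarith)
      have m3 : min aq aj = aq := min_eq_left (by linarith)
      rw [m3]
      rw [← hap, ← haq, ← haj, ← haz, m1, m2] at key
      linarith

/-- **Spectator exchange, spectator-weakest case** (T(i) of the memo = the lead's Ψ: the regime-A′ atom of the formal face):
if `a_j ≤ a_p` and `a_j ≤ a_{p′}` then `a_j − a_z ≤ D`. [cite: KozmaNitzan2024, Lemma 4 and (9) (pp. 9–10), Question 7 (p. 36)] -/
theorem spectatorExchange_weakest (w : Sym2 V → unitInterval) (b z j p p' : V)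
    (hzb : z ≠ b) (hpb : p ≠ b) (hp'b : p' ≠ b) (hjb : j ≠ b) (hpp' : p ≠ p') (hpj : p ≠ j) (hp'j : p' ≠ j)
    (hjp : (prodBernoulli w).real (openConn j b) ≤ (prodBernoulli w).real (openConn p b))
    (hjp' : (prodBernoulli w).real (openConn j b) ≤ (prodBernoulli w).real (openConn p' b)) :
    (prodBernoulli w).real (openConn j b) - (prodBernoulli w).real (openConn z b) ≤
      (prodBernoulli w).real ((openConn p b ∪ openConn p' b) ∩ (openConn z b)ᶜ ∩ (openConn z p)ᶜ ∩
          (openConn z p')ᶜ ∩ (openConn z j)ᶜ) -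
        (prodBernoulli w).real (openConn z b ∩ (openConn p b)ᶜ ∩ (openConn p' b)ᶜ ∩ (openConn j p ∪ openConn j p')) := by
  have key := spectatorExchange_min w b z j p p' hzb hpb hp'b hjb hpp' hpj hp'j
  have hm : min (min ((prodBernoulli w).real (openConn p b)) ((prodBernoulli w).real (openConn p' b)))
      ((prodBernoulli w).real (openConn j b)) = (prodBernoulli w).real (openConn j b) :=
    min_eq_right (le_min hjp hjp')
  rw [hm] at key
  exact key

/-- **Spectator-weakest exchange, gain form**: under `a_j ≤ a_p`, `a_j ≤ a_{p′}`,
`P(z↔b, A↮b, j↔A) + P(j↔b) ≤ P(A↔b, z ≁ b,p,p′,j) + P(z↔b)`. [cite: KozmaNitzan2024, (9) (pp. 9–10), Question 7 (p. 36)] -/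
theorem spectatorExchange_weakest' (w : Sym2 V → unitInterval) (b z j p p' : V)
    (hzb : z ≠ b) (hpb : p ≠ b) (hp'b : p' ≠ b) (hjb : j ≠ b) (hpp' : p ≠ p') (hpj : p ≠ j) (hp'j : p' ≠ j)
    (hjp : (prodBernoulli w).real (openConn j b) ≤ (prodBernoulli w).real (openConn p b))
    (hjp' : (prodBernoulli w).real (openConn j b) ≤ (prodBernoulli w).real (openConn p' b)) :
    (prodBernoulli w).real (openConn z b ∩ (openConn p b)ᶜ ∩ (openConn p' b)ᶜ ∩ (openConn j p ∪ openConn j p')) +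
        (prodBernoulli w).real (openConn j b) ≤
      (prodBernoulli w).real ((openConn p b ∪ openConn p' b) ∩ (openConn z b)ᶜ ∩ (openConn z p)ᶜ ∩
          (openConn z p')ᶜ ∩ (openConn z j)ᶜ) + (prodBernoulli w).real (openConn z b) := by
  have h := spectatorExchange_weakest w b z j p p' hzb hpb hp'b hjb hpp' hpj hp'j hjp hjp'
  linarith

end UpsetExchange

end

end Summit.CriticalPhenomena.PercolationContinuityZ3.Theorems
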